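import Literature.NumberTheory.Rogawski1990.ArchCompactWallTransversalFrame       -- (A2″) part 2b-II(a) (this seat): integrability, Pauli form, frame elements (brings ★ part 1, ★ 2a, 2b-I′)
import Literature.LinearAlgebra.Matrix.UnitaryBlockPauliFrameTrace                 -- (A2″) part 2b-I (this seat): invariance of the Pauli-frame sum
import Mathlib.Tactic.Module
import HarnessLib

/-!
# ROAD A (A2″) part 2b-II(b) — THE TRACE FORM OF `N²Φ` AT A COMPACT WALL: a class function on the singular orbit `G_w ∕ Z(t₀)`, ready for the ball chart
# (Rogawski 1990 §8.4 p. 126; the input of the `H²_ℂ` hat-box chart ★ (A3-a)–(A3-c′) and of the (A4) value, F0P3a-p05 census 19b229d9 §2)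

Topic `NumberTheory/Automorphic`; namespace `Literature.NumberTheory.Automorphic.UnitaryGroup`.  THEOREMS ONLY (no `def`, no instance, no notation, no axiom, no named fact, no
`sorry`).  Cell `pub/hodgecm-mathlib`, ENGINE T1 (crux H413 = `stmt-HodgeConjecture-24833`); ROAD A toward the (L_{U(2,1)}) letter N1 `stub_ArchCentralLimitU21` (owner F0P3a-p05;
chair F0P3a-plan WORD T9-8 (D) «(A2″) part 2 = ball-chart form»); brick **(A2″) part 2b-II(b)** (§4–§5), over part 2b-II(a) `ArchCompactWallTransversalFrame` (§1–§3: integrability, Pauli form, frame elements), ★ part 2a and 2b-I; author A-p14 (g28).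

THE MATHEMATICS.  `G_w = archLocal L N (diagonal α) w` (`e_k = σ_w(α_k)` real non-zero), a compact-wall point `t₀ = diag ζ` (`i ≠ j`, `ζ_i = ζ_j`, the `b`-block of `i` is `{i,j}`, and — for the
frame — `e_i = e_j`, so that the `(i,j)`-block of `Z(t₀)` is an honest `U(2)`), the Pauli frame `y₁ = i(E_ii − E_jj)`, `y₂ = E_ij − E_ji`, `y₃ = i(E_ij + E_ji)`, `h_g = ↑↑(g t₀ g⁻¹)`,
`Q_g = ↑↑g (E_ii + E_jj) ↑↑g⁻¹`, `Ad(g)Y = ↑↑g · Y · ↑↑g⁻¹`.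
* §1–§3 live in part 2b-II(a) `ArchCompactWallTransversalFrame`: integrability in `g` of `∂²_y|₀ Θ(↑↑(g (u t_y u⁻¹) g⁻¹))`, the pointwise wall formula in Pauli form, and the frame
  elements `m₂, m₃ ∈ Z(t₀)` with `Ad(m₂)y₁ = y₃`, `Ad(m₃)y₁ = y₂` (`exists_frame_rotations_mem_centralizer`).
* §4 **`iteratedDeriv_two_integral_wallLine_eq_integral_third_trace_sub_gradient`** — THE TRACE FORM: averaging ★ (A2′) (`N²Φ = ∫ ∂²Θ(g (u t_y u⁻¹) g⁻¹)` for every `u`) over `u ∈ {1, m₃, m₂}`,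
  **`N²Φ_Θ(t₀) = ∫_{G_w} ( ⅓ Σ_{a=1}^{3} D²Θ(h_g)[ζ_i • Ad(g) y_a, ζ_i • Ad(g) y_a] − DΘ(h_g)[ζ_i • Q_g] ) dν(g)`** — `⅓ Σ_a` is the normalised `S²`-average of the quadratic form
  `X ↦ D²Θ(h_g)[ζ_i • Ad(g)X]²` on the unit sphere of `𝔰𝔲(2)` (p05's `∫_{S²} dσ`); `Θ` is only `ℝ`-differentiable, so `ζ_i` stays inside.
* §5 **THE INTEGRAND IS A CLASS FUNCTION ON `G_w ∕ Z(t₀)`**: `sum_frame_conj_mul_centralizer_eq` (the Hessian frame sum at `g m` equals the one at `g`, `m ∈ Z(t₀)` — 2b-I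
  `sum_conj_frame_eq_sum_frame` with `q(X,Y) = B[c•Ad(g)X, c•Ad(g)Y]`, `M = ↑↑m` `H`-unitary and block-diagonal) and `third_trace_sub_gradient_mul_centralizer_eq` (the whole integrand; the
  gradient term by ★ 2a `conj_mul_single_add_single_conj_eq_of_mem_centralizer`).  At `N = 3`, `α = (1,1,−1)`, `(i,j) = (0,1)`: `Z(t₀) = Stab(x₀)`, `Q_g = 1 − P(lift(g • x₀))`
  (★ 2a §4, ★ (A3-a) `mat_conj_kCentral_eq`), so the integrand is `F(g • x₀)` with `F :=` integrand `∘ sec` (★ `UnitBallSection`) and ★ (A3-a)'s push-forward applies verbatim.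
HONEST LABEL: HC_CM is proved only modulo the printed citations until rung 0 closes; calculus, matrix algebra and bookkeeping, pays nothing by itself.

## References
* [Rogawski1990] J. D. Rogawski, *Automorphic Representations of Unitary Groups in Three Variables*, Ann. of Math. Stud. 123 (1990), §8.2 pp. 122–123, §8.4 p. 126.
* [Varadarajan1989] V. S. Varadarajan, *An Introduction to Harmonic Analysis on Semisimple Lie Groups* (1989), §6.4 (second-order germs of orbital integrals at singular points; `G∕K` reduction).
* [Helgason2000] S. Helgason, *Groups and Geometric Analysis* (2000), Ch. II §4 (radial parts; spherical averages of quadratic forms, `∫_{S²}(n·σ)⊗(n·σ)dσ = ⅓Σσ_a⊗σ_a`).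
* [HormanderALPDO1] L. Hörmander, *The Analysis of Linear Partial Differential Operators I*, Thm. 1.1.9.
-/

set_option autoImplicit false

noncomputable section

open MeasureTheory Measure Filter Topology Set Function Metric NumberField NumberField.InfinitePlace Complex
open scoped ContDiff ComplexConjugate

namespace Literature.NumberTheory.Automorphic.UnitaryGroup

open Literature.Analysis.Calculus
open scoped _root_.Matrix MatrixGroups   -- `_root_`: inside `namespace Literature.…` the bare `Matrix` resolves to a `Literature.…Matrix` namespace and the `ᵀ`∕`ᴴ` notations would not open
open scoped Matrix.Norms.Operator

/-! ## §4 The trace form of `N²Φ|_{wall}` -/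

section Trace

variable (L : Type) [Field L] (N : ℕ) (α : Fin N → L) (w : {w : InfinitePlace L // IsComplex w})
  {E : Type*} [NormedAddCommGroup E] [NormedSpace ℝ E] [CompleteSpace E]
  [MeasurableSpace (archLocal L N (Matrix.diagonal α) w)] [BorelSpace (archLocal L N (Matrix.diagonal α) w)]

/-- **THE TRACE FORM OF `N²Φ|_{wall}`**: under the hypotheses of ★ (A2′) (`e_k` real non-zero, constant-sign labelling `b`, `ζ` block-separated, `Θ` smooth with compact support on `G_w`, `ν`
right-invariant and finite on compacts), at a compact-wall point (`i ≠ j`, `ζ_i = ζ_j`, `b`-block of `i` equal to `{i,j}`) with `σ_w(α_i) = σ_w(α_j)`: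
`∂²_y|₀ ∫ Θ(↑↑(g t_y g⁻¹)) dν = ∫ ( ⅓ • ( D²Θ(h_g)[ζ_i•Ad(g)y₁]² + D²Θ(h_g)[ζ_i•Ad(g)y₂]² + D²Θ(h_g)[ζ_i•Ad(g)y₃]² ) − DΘ(h_g)[ζ_i • Q_g] ) dν(g)` — the average of ★ (A2′) over the three
frame elements `1, m₃, m₂` of §3 (§1 makes each summand integrable).  The bracket is a class function on `G_w∕Z(t₀)` (§5); `⅓Σ_a` = the `S²`-average of the transversal Hessian.
[cite: Rogawski1990, §8.4 p. 126] [cite: Varadarajan1989, §6.4] [cite: Helgason2000, Ch. II §4] -/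
theorem iteratedDeriv_two_integral_wallLine_eq_integral_third_trace_sub_gradient (hα : ∀ i, α i ≠ 0) (hreal : ∀ i, (w.1.embedding (α i)).im = 0)
    {ι : Type*} (b : Fin N → ι) (hsign : ∀ i j, i ≠ j → b i = b j → 0 < (w.1.embedding (α i)).re * (w.1.embedding (α j)).re)
    (ν : Measure (archLocal L N (Matrix.diagonal α) w)) [IsFiniteMeasureOnCompacts ν] [ν.IsMulRightInvariant]
    (Θ : Matrix (Fin N) (Fin N) ℂ → E) (hΘ : ContDiff ℝ ∞ Θ) (hfc : HasCompactSupport fun k : archLocal L N (Matrix.diagonal α) w => Θ (((k : GL (Fin N) ℂ) : Matrix (Fin N) (Fin N) ℂ)))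
    (ζ : Fin N → Circle) (hζ : ∀ k l, b k ≠ b l → ζ k ≠ ζ l) {i j : Fin N} (hij : i ≠ j) (hζij : ζ i = ζ j) (hb : ∀ k, b k = b i ↔ (k = i ∨ k = j))
    (hαij : w.1.embedding (α i) = w.1.embedding (α j)) :
    iteratedDeriv 2 (fun y : ℝ => ∫ g : archLocal L N (Matrix.diagonal α) w,
        Θ ((((g * ⟨circleDiagonal N fun k => ζ k * Circle.exp (y * ((if k = i then 1 else 0) - (if k = j then 1 else 0))),
          circleDiagonal_mem_archLocal_diagonal L N α w _⟩ * g⁻¹ : archLocal L N (Matrix.diagonal α) w) : GL (Fin N) ℂ) : Matrix (Fin N) (Fin N) ℂ)) ∂ν) 0 =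
      ∫ g : archLocal L N (Matrix.diagonal α) w,
        ((1 / 3 : ℝ) • (iteratedFDeriv ℝ 2 Θ
              (((g * ⟨circleDiagonal N ζ, circleDiagonal_mem_archLocal_diagonal L N α w ζ⟩ * g⁻¹ : archLocal L N (Matrix.diagonal α) w) : GL (Fin N) ℂ) : Matrix (Fin N) (Fin N) ℂ)
              ![(ζ i : ℂ) • ((((g : archLocal L N (Matrix.diagonal α) w) : GL (Fin N) ℂ) : Matrix (Fin N) (Fin N) ℂ) * (I • (Matrix.single i i (1 : ℂ) - Matrix.single j j 1)) *
                  (((g⁻¹ : archLocal L N (Matrix.diagonal α) w) : GL (Fin N) ℂ) : Matrix (Fin N) (Fin N) ℂ)),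
                (ζ i : ℂ) • ((((g : archLocal L N (Matrix.diagonal α) w) : GL (Fin N) ℂ) : Matrix (Fin N) (Fin N) ℂ) * (I • (Matrix.single i i (1 : ℂ) - Matrix.single j j 1)) *
                  (((g⁻¹ : archLocal L N (Matrix.diagonal α) w) : GL (Fin N) ℂ) : Matrix (Fin N) (Fin N) ℂ))] +
            iteratedFDeriv ℝ 2 Θ
              (((g * ⟨circleDiagonal N ζ, circleDiagonal_mem_archLocal_diagonal L N α w ζ⟩ * g⁻¹ : archLocal L N (Matrix.diagonal α) w) : GL (Fin N) ℂ) : Matrix (Fin N) (Fin N) ℂ)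
              ![(ζ i : ℂ) • ((((g : archLocal L N (Matrix.diagonal α) w) : GL (Fin N) ℂ) : Matrix (Fin N) (Fin N) ℂ) * (Matrix.single i j (1 : ℂ) - Matrix.single j i 1) *
                  (((g⁻¹ : archLocal L N (Matrix.diagonal α) w) : GL (Fin N) ℂ) : Matrix (Fin N) (Fin N) ℂ)),
                (ζ i : ℂ) • ((((g : archLocal L N (Matrix.diagonal α) w) : GL (Fin N) ℂ) : Matrix (Fin N) (Fin N) ℂ) * (Matrix.single i j (1 : ℂ) - Matrix.single j i 1) *
                  (((g⁻¹ : archLocal L N (Matrix.diagonal α) w) : GL (Fin N) ℂ) : Matrix (Fin N) (Fin N) ℂ))] +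
            iteratedFDeriv ℝ 2 Θ
              (((g * ⟨circleDiagonal N ζ, circleDiagonal_mem_archLocal_diagonal L N α w ζ⟩ * g⁻¹ : archLocal L N (Matrix.diagonal α) w) : GL (Fin N) ℂ) : Matrix (Fin N) (Fin N) ℂ)
              ![(ζ i : ℂ) • ((((g : archLocal L N (Matrix.diagonal α) w) : GL (Fin N) ℂ) : Matrix (Fin N) (Fin N) ℂ) * (I • (Matrix.single i j (1 : ℂ) + Matrix.single j i 1)) *
                  (((g⁻¹ : archLocal L N (Matrix.diagonal α) w) : GL (Fin N) ℂ) : Matrix (Fin N) (Fin N) ℂ)),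
                (ζ i : ℂ) • ((((g : archLocal L N (Matrix.diagonal α) w) : GL (Fin N) ℂ) : Matrix (Fin N) (Fin N) ℂ) * (I • (Matrix.single i j (1 : ℂ) + Matrix.single j i 1)) *
                  (((g⁻¹ : archLocal L N (Matrix.diagonal α) w) : GL (Fin N) ℂ) : Matrix (Fin N) (Fin N) ℂ))]) -
          fderiv ℝ Θ
            (((g * ⟨circleDiagonal N ζ, circleDiagonal_mem_archLocal_diagonal L N α w ζ⟩ * g⁻¹ : archLocal L N (Matrix.diagonal α) w) : GL (Fin N) ℂ) : Matrix (Fin N) (Fin N) ℂ)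
            ((ζ i : ℂ) • ((((g : archLocal L N (Matrix.diagonal α) w) : GL (Fin N) ℂ) : Matrix (Fin N) (Fin N) ℂ) * (Matrix.single i i (1 : ℂ) + Matrix.single j j 1) *
              (((g⁻¹ : archLocal L N (Matrix.diagonal α) w) : GL (Fin N) ℂ) : Matrix (Fin N) (Fin N) ℂ)))) ∂ν := by
  have hS : ∀ k, ζ k = ζ i ↔ (k = i ∨ k = j) := fun k => by
    refine ⟨fun h => ?_, fun h => ?_⟩
    · by_contra hk
      exact hζ k i (fun hbk => hk ((hb k).1 hbk)) h
    · rcases h with h | h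
      · rw [h]
      · rw [h, hζij]
  obtain ⟨m₂, m₃, hm₂, hm₃, hy₃, hy₂⟩ := exists_frame_rotations_mem_centralizer L N α w hij hαij ζ hζij
  have h1 : (1 : archLocal L N (Matrix.diagonal α) w) ∈ Subgroup.centralizer ({(⟨circleDiagonal N ζ, circleDiagonal_mem_archLocal_diagonal L N α w ζ⟩ :
      archLocal L N (Matrix.diagonal α) w)} : Set (archLocal L N (Matrix.diagonal α) w)) := Subgroup.one_mem _
  have hy₁ : (((1 : archLocal L N (Matrix.diagonal α) w) : GL (Fin N) ℂ) : Matrix (Fin N) (Fin N) ℂ) * (I • (Matrix.single i i (1 : ℂ) - Matrix.single j j 1)) *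
      ((((1 : archLocal L N (Matrix.diagonal α) w)⁻¹ : archLocal L N (Matrix.diagonal α) w) : GL (Fin N) ℂ) : Matrix (Fin N) (Fin N) ℂ) =
        I • (Matrix.single i i (1 : ℂ) - Matrix.single j j 1) := by
    rw [inv_one, Subgroup.coe_one, Units.val_one, Matrix.one_mul, Matrix.mul_one]
  -- the three integral identities (★ (A2′) at `u := 1, m₃, m₂`) and the three pointwise Pauli forms
  have hI := fun (m : archLocal L N (Matrix.diagonal α) w) =>
    iteratedDeriv_two_integral_comp_conj_circleDiagonal_wallLine_eq_integral_conj L N α w hα hreal b hsign ν Θ hΘ hfc ζ hζ i j m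
  have hP := fun (g m : archLocal L N (Matrix.diagonal α) w) (hm : m ∈ Subgroup.centralizer ({(⟨circleDiagonal N ζ, circleDiagonal_mem_archLocal_diagonal L N α w ζ⟩ :
      archLocal L N (Matrix.diagonal α) w)} : Set (archLocal L N (Matrix.diagonal α) w))) =>
    iteratedDeriv_two_comp_conj_conj_wallLine_eq_hessian_pauli_sub_gradient L N α w hij ζ hS Θ (hΘ.of_le (WithTop.coe_le_coe.2 le_top)) g m hm
  have hInt := fun (m : archLocal L N (Matrix.diagonal α) w) =>
    integrable_iteratedDeriv_two_comp_conj_conj_wallLine L N α w hα hreal b hsign ν Θ hΘ hfc ζ hζ i j m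
  -- sum of the three identities
  have h3 : (3 : ℝ) • iteratedDeriv 2 (fun y : ℝ => ∫ g : archLocal L N (Matrix.diagonal α) w,
        Θ ((((g * ⟨circleDiagonal N fun k => ζ k * Circle.exp (y * ((if k = i then 1 else 0) - (if k = j then 1 else 0))),
          circleDiagonal_mem_archLocal_diagonal L N α w _⟩ * g⁻¹ : archLocal L N (Matrix.diagonal α) w) : GL (Fin N) ℂ) : Matrix (Fin N) (Fin N) ℂ)) ∂ν) 0 =
      ∫ g : archLocal L N (Matrix.diagonal α) w, (iteratedDeriv 2 (fun y : ℝ =>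
        Θ ((((g * ((1 : archLocal L N (Matrix.diagonal α) w) * ⟨circleDiagonal N fun k => ζ k * Circle.exp (y * ((if k = i then 1 else 0) - (if k = j then 1 else 0))),
          circleDiagonal_mem_archLocal_diagonal L N α w _⟩ * (1 : archLocal L N (Matrix.diagonal α) w)⁻¹) * g⁻¹ : archLocal L N (Matrix.diagonal α) w) : GL (Fin N) ℂ) :
            Matrix (Fin N) (Fin N) ℂ))) 0 +
        iteratedDeriv 2 (fun y : ℝ =>
        Θ ((((g * (m₃ * ⟨circleDiagonal N fun k => ζ k * Circle.exp (y * ((if k = i then 1 else 0) - (if k = j then 1 else 0))),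
          circleDiagonal_mem_archLocal_diagonal L N α w _⟩ * m₃⁻¹) * g⁻¹ : archLocal L N (Matrix.diagonal α) w) : GL (Fin N) ℂ) : Matrix (Fin N) (Fin N) ℂ))) 0 +
        iteratedDeriv 2 (fun y : ℝ =>
        Θ ((((g * (m₂ * ⟨circleDiagonal N fun k => ζ k * Circle.exp (y * ((if k = i then 1 else 0) - (if k = j then 1 else 0))),
          circleDiagonal_mem_archLocal_diagonal L N α w _⟩ * m₂⁻¹) * g⁻¹ : archLocal L N (Matrix.diagonal α) w) : GL (Fin N) ℂ) : Matrix (Fin N) (Fin N) ℂ))) 0) ∂ν := by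
    have e1 := hI 1
    have e3 := hI m₃
    have e2 := hI m₂
    rw [show (3 : ℝ) = 1 + 1 + 1 by norm_num, add_smul, add_smul, one_smul, integral_add ?_ (hInt m₂),
      integral_add (hInt 1) (hInt m₃), ← e1, ← e3, ← e2]
    exact (hInt 1).add (hInt m₃)
  have h3' : iteratedDeriv 2 (fun y : ℝ => ∫ g : archLocal L N (Matrix.diagonal α) w,
        Θ ((((g * ⟨circleDiagonal N fun k => ζ k * Circle.exp (y * ((if k = i then 1 else 0) - (if k = j then 1 else 0))),
          circleDiagonal_mem_archLocal_diagonal L N α w _⟩ * g⁻¹ : archLocal L N (Matrix.diagonal α) w) : GL (Fin N) ℂ) : Matrix (Fin N) (Fin N) ℂ)) ∂ν) 0 =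
      (1 / 3 : ℝ) • ∫ g : archLocal L N (Matrix.diagonal α) w, (iteratedDeriv 2 (fun y : ℝ =>
        Θ ((((g * ((1 : archLocal L N (Matrix.diagonal α) w) * ⟨circleDiagonal N fun k => ζ k * Circle.exp (y * ((if k = i then 1 else 0) - (if k = j then 1 else 0))),
          circleDiagonal_mem_archLocal_diagonal L N α w _⟩ * (1 : archLocal L N (Matrix.diagonal α) w)⁻¹) * g⁻¹ : archLocal L N (Matrix.diagonal α) w) : GL (Fin N) ℂ) :
            Matrix (Fin N) (Fin N) ℂ))) 0 +
        iteratedDeriv 2 (fun y : ℝ =>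
        Θ ((((g * (m₃ * ⟨circleDiagonal N fun k => ζ k * Circle.exp (y * ((if k = i then 1 else 0) - (if k = j then 1 else 0))),
          circleDiagonal_mem_archLocal_diagonal L N α w _⟩ * m₃⁻¹) * g⁻¹ : archLocal L N (Matrix.diagonal α) w) : GL (Fin N) ℂ) : Matrix (Fin N) (Fin N) ℂ))) 0 +
        iteratedDeriv 2 (fun y : ℝ =>
        Θ ((((g * (m₂ * ⟨circleDiagonal N fun k => ζ k * Circle.exp (y * ((if k = i then 1 else 0) - (if k = j then 1 else 0))),
          circleDiagonal_mem_archLocal_diagonal L N α w _⟩ * m₂⁻¹) * g⁻¹ : archLocal L N (Matrix.diagonal α) w) : GL (Fin N) ℂ) : Matrix (Fin N) (Fin N) ℂ))) 0) ∂ν := by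
    rw [← h3, smul_smul]; norm_num
  rw [h3', ← integral_smul]
  congr 1
  funext g
  rw [hP g 1 h1, hP g m₃ hm₃, hP g m₂ hm₂, hy₁, hy₃, hy₂]
  module

end Trace


/-! ## §5 The integrand is a class function on `G_w ∕ Z(t₀)` -/

section Invariance

variable (L : Type) [Field L] (N : ℕ) (α : Fin N → L) (w : {w : InfinitePlace L // IsComplex w})
  {E : Type*} [NormedAddCommGroup E] [NormedSpace ℝ E]

open Literature.LinearAlgebra.Matrix.SU2Block in
/-- **THE HESSIAN FRAME SUM IS RIGHT-`Z(t₀)`-INVARIANT**: for every continuous real bilinear `B` on `M_N(ℂ)`, scalar `c`, `g ∈ G_w` and `m ∈ Z_{G_w}(t₀)` (`ζ`-class of `i` = `{i,j}`,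
`σ_w(α_i) = σ_w(α_j)`, `e_k` real non-zero): `Σ_a B[c•Ad(gm)y_a]² = Σ_a B[c•Ad(g)y_a]²` — 2b-I `sum_conj_frame_eq_sum_frame` for `q(X,Y) = B[c•Ad(g)X, c•Ad(g)Y]` and `M = ↑↑m`
(`H`-unitary for `H = diag σ_w(α)`, block-diagonal because it commutes with `diag ζ`). [cite: Rogawski1990, §8.4 p. 126] [cite: Helgason2000, Ch. II §4] -/
theorem sum_frame_conj_mul_centralizer_eq (hα : ∀ i, α i ≠ 0) (hreal : ∀ i, (w.1.embedding (α i)).im = 0) {i j : Fin N} (hij : i ≠ j)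
    (hαij : w.1.embedding (α i) = w.1.embedding (α j)) (ζ : Fin N → Circle) (hS : ∀ k, ζ k = ζ i ↔ (k = i ∨ k = j))
    (B : ContinuousMultilinearMap ℝ (fun _ : Fin 2 => Matrix (Fin N) (Fin N) ℂ) E) (c : ℂ) (g m : archLocal L N (Matrix.diagonal α) w)
    (hm : m ∈ Subgroup.centralizer ({(⟨circleDiagonal N ζ, circleDiagonal_mem_archLocal_diagonal L N α w ζ⟩ : archLocal L N (Matrix.diagonal α) w)} :
      Set (archLocal L N (Matrix.diagonal α) w))) :
    B ![c • ((((g * m : archLocal L N (Matrix.diagonal α) w) : GL (Fin N) ℂ) : Matrix (Fin N) (Fin N) ℂ) * (I • (Matrix.single i i (1 : ℂ) - Matrix.single j j 1)) *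
          ((((g * m)⁻¹ : archLocal L N (Matrix.diagonal α) w) : GL (Fin N) ℂ) : Matrix (Fin N) (Fin N) ℂ)),
        c • ((((g * m : archLocal L N (Matrix.diagonal α) w) : GL (Fin N) ℂ) : Matrix (Fin N) (Fin N) ℂ) * (I • (Matrix.single i i (1 : ℂ) - Matrix.single j j 1)) *
          ((((g * m)⁻¹ : archLocal L N (Matrix.diagonal α) w) : GL (Fin N) ℂ) : Matrix (Fin N) (Fin N) ℂ))] +
      B ![c • ((((g * m : archLocal L N (Matrix.diagonal α) w) : GL (Fin N) ℂ) : Matrix (Fin N) (Fin N) ℂ) * (Matrix.single i j (1 : ℂ) - Matrix.single j i 1) *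
          ((((g * m)⁻¹ : archLocal L N (Matrix.diagonal α) w) : GL (Fin N) ℂ) : Matrix (Fin N) (Fin N) ℂ)),
        c • ((((g * m : archLocal L N (Matrix.diagonal α) w) : GL (Fin N) ℂ) : Matrix (Fin N) (Fin N) ℂ) * (Matrix.single i j (1 : ℂ) - Matrix.single j i 1) *
          ((((g * m)⁻¹ : archLocal L N (Matrix.diagonal α) w) : GL (Fin N) ℂ) : Matrix (Fin N) (Fin N) ℂ))] +
      B ![c • ((((g * m : archLocal L N (Matrix.diagonal α) w) : GL (Fin N) ℂ) : Matrix (Fin N) (Fin N) ℂ) * (I • (Matrix.single i j (1 : ℂ) + Matrix.single j i 1)) *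
          ((((g * m)⁻¹ : archLocal L N (Matrix.diagonal α) w) : GL (Fin N) ℂ) : Matrix (Fin N) (Fin N) ℂ)),
        c • ((((g * m : archLocal L N (Matrix.diagonal α) w) : GL (Fin N) ℂ) : Matrix (Fin N) (Fin N) ℂ) * (I • (Matrix.single i j (1 : ℂ) + Matrix.single j i 1)) *
          ((((g * m)⁻¹ : archLocal L N (Matrix.diagonal α) w) : GL (Fin N) ℂ) : Matrix (Fin N) (Fin N) ℂ))] =
    B ![c • ((((g : archLocal L N (Matrix.diagonal α) w) : GL (Fin N) ℂ) : Matrix (Fin N) (Fin N) ℂ) * (I • (Matrix.single i i (1 : ℂ) - Matrix.single j j 1)) *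
          (((g⁻¹ : archLocal L N (Matrix.diagonal α) w) : GL (Fin N) ℂ) : Matrix (Fin N) (Fin N) ℂ)),
        c • ((((g : archLocal L N (Matrix.diagonal α) w) : GL (Fin N) ℂ) : Matrix (Fin N) (Fin N) ℂ) * (I • (Matrix.single i i (1 : ℂ) - Matrix.single j j 1)) *
          (((g⁻¹ : archLocal L N (Matrix.diagonal α) w) : GL (Fin N) ℂ) : Matrix (Fin N) (Fin N) ℂ))] +
      B ![c • ((((g : archLocal L N (Matrix.diagonal α) w) : GL (Fin N) ℂ) : Matrix (Fin N) (Fin N) ℂ) * (Matrix.single i j (1 : ℂ) - Matrix.single j i 1) *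
          (((g⁻¹ : archLocal L N (Matrix.diagonal α) w) : GL (Fin N) ℂ) : Matrix (Fin N) (Fin N) ℂ)),
        c • ((((g : archLocal L N (Matrix.diagonal α) w) : GL (Fin N) ℂ) : Matrix (Fin N) (Fin N) ℂ) * (Matrix.single i j (1 : ℂ) - Matrix.single j i 1) *
          (((g⁻¹ : archLocal L N (Matrix.diagonal α) w) : GL (Fin N) ℂ) : Matrix (Fin N) (Fin N) ℂ))] +
      B ![c • ((((g : archLocal L N (Matrix.diagonal α) w) : GL (Fin N) ℂ) : Matrix (Fin N) (Fin N) ℂ) * (I • (Matrix.single i j (1 : ℂ) + Matrix.single j i 1)) *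
          (((g⁻¹ : archLocal L N (Matrix.diagonal α) w) : GL (Fin N) ℂ) : Matrix (Fin N) (Fin N) ℂ)),
        c • ((((g : archLocal L N (Matrix.diagonal α) w) : GL (Fin N) ℂ) : Matrix (Fin N) (Fin N) ℂ) * (I • (Matrix.single i j (1 : ℂ) + Matrix.single j i 1)) *
          (((g⁻¹ : archLocal L N (Matrix.diagonal α) w) : GL (Fin N) ℂ) : Matrix (Fin N) (Fin N) ℂ))] := by
  -- abbreviations
  obtain ⟨G, hG⟩ : ∃ G : Matrix (Fin N) (Fin N) ℂ, G = (((g : archLocal L N (Matrix.diagonal α) w) : GL (Fin N) ℂ) : Matrix (Fin N) (Fin N) ℂ) := ⟨_, rfl⟩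
  obtain ⟨G', hG'⟩ : ∃ G' : Matrix (Fin N) (Fin N) ℂ, G' = (((g⁻¹ : archLocal L N (Matrix.diagonal α) w) : GL (Fin N) ℂ) : Matrix (Fin N) (Fin N) ℂ) := ⟨_, rfl⟩
  obtain ⟨M, hM⟩ : ∃ M : Matrix (Fin N) (Fin N) ℂ, M = (((m : archLocal L N (Matrix.diagonal α) w) : GL (Fin N) ℂ) : Matrix (Fin N) (Fin N) ℂ) := ⟨_, rfl⟩
  obtain ⟨M', hM'⟩ : ∃ M' : Matrix (Fin N) (Fin N) ℂ, M' = (((m⁻¹ : archLocal L N (Matrix.diagonal α) w) : GL (Fin N) ℂ) : Matrix (Fin N) (Fin N) ℂ) := ⟨_, rfl⟩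
  have hgm : (((g * m : archLocal L N (Matrix.diagonal α) w) : GL (Fin N) ℂ) : Matrix (Fin N) (Fin N) ℂ) = G * M := by
    rw [hG, hM]; simp only [Subgroup.coe_mul, Units.val_mul]
  have hgm' : ((((g * m)⁻¹ : archLocal L N (Matrix.diagonal α) w) : GL (Fin N) ℂ) : Matrix (Fin N) (Fin N) ℂ) = M' * G' := by
    rw [hG', hM', _root_.mul_inv_rev]; simp only [Subgroup.coe_mul, Units.val_mul]
  -- the real bilinear map `q(X, Y) = B[c•(G X G'), c•(G Y G')]`
  have hadd0 : ∀ a b v : Matrix (Fin N) (Fin N) ℂ, B ![a + b, v] = B ![a, v] + B ![b, v] := fun a b v => B.toMultilinearMap.cons_add ![v] a b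
  have hsmul0 : ∀ (r : ℝ) (a v : Matrix (Fin N) (Fin N) ℂ), B ![r • a, v] = r • B ![a, v] := fun r a v => B.toMultilinearMap.cons_smul ![v] r a
  have hupd : ∀ v x : Matrix (Fin N) (Fin N) ℂ, Function.update ![v, v] 1 x = ![v, x] := fun v x => by
    funext k; fin_cases k <;> simp
  have hadd1 : ∀ v a b : Matrix (Fin N) (Fin N) ℂ, B ![v, a + b] = B ![v, a] + B ![v, b] := fun v a b => by
    rw [← hupd v (a + b), ← hupd v a, ← hupd v b]; exact B.map_update_add _ 1 a b
  have hsmul1 : ∀ (r : ℝ) (v a : Matrix (Fin N) (Fin N) ℂ), B ![v, r • a] = r • B ![v, a] := fun r v a => by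
    rw [← hupd v (r • a), ← hupd v a]; exact B.map_update_smul _ 1 r a
  obtain ⟨q, hq⟩ : ∃ q : Matrix (Fin N) (Fin N) ℂ →ₗ[ℝ] Matrix (Fin N) (Fin N) ℂ →ₗ[ℝ] E, ∀ X Y, q X Y = B ![c • (G * X * G'), c • (G * Y * G')] := by
    refine ⟨LinearMap.mk₂ ℝ (fun X Y => B ![c • (G * X * G'), c • (G * Y * G')]) (fun X X' Y => ?_) (fun r X Y => ?_) (fun X Y Y' => ?_) (fun r X Y => ?_),
      fun X Y => rfl⟩
    · simp only [Matrix.mul_add, Matrix.add_mul, smul_add, hadd0]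
    · simp only [Matrix.smul_mul, Matrix.mul_smul, smul_comm c r, hsmul0]
    · simp only [Matrix.mul_add, Matrix.add_mul, smul_add, hadd1]
    · simp only [Matrix.smul_mul, Matrix.mul_smul, smul_comm c r, hsmul1]
  -- hypotheses of the linear-algebra invariance
  have hS' : ∀ k, (ζ k : ℂ) = ζ i ↔ (k = i ∨ k = j) := fun k => by rw [← hS k]; exact ⟨fun h => Circle.ext h, fun h => by rw [h]⟩
  have he : ∀ k, w.1.embedding (α k) ≠ 0 := fun k => (map_ne_zero _).2 (hα k)
  have hereal : ∀ k, conj (w.1.embedding (α k)) = w.1.embedding (α k) := fun k => Complex.conj_eq_iff_im.2 (hreal k)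
  have hMH : Mᴴ * Matrix.diagonal (fun k => w.1.embedding (α k)) * M = Matrix.diagonal (fun k => w.1.embedding (α k)) := by
    have h := m.2
    rw [mem_archLocal_iff, Matrix.diagonal_map (map_zero _)] at h
    rw [hM]; exact h
  have hMM' : M * M' = 1 := by rw [hM, hM', ← Units.val_mul, ← Subgroup.coe_mul, mul_inv_cancel, Subgroup.coe_one, Units.val_one]
  have hM'M : M' * M = 1 := by rw [hM, hM', ← Units.val_mul, ← Subgroup.coe_mul, inv_mul_cancel, Subgroup.coe_one, Units.val_one]
  have hMd : M * Matrix.diagonal (fun k => (ζ k : ℂ)) = Matrix.diagonal (fun k => (ζ k : ℂ)) * M := by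
    have hc : (⟨circleDiagonal N ζ, circleDiagonal_mem_archLocal_diagonal L N α w ζ⟩ : archLocal L N (Matrix.diagonal α) w) * m =
        m * ⟨circleDiagonal N ζ, circleDiagonal_mem_archLocal_diagonal L N α w ζ⟩ := Subgroup.mem_centralizer_iff.1 hm _ (Set.mem_singleton _)
    have h := congrArg (fun x : archLocal L N (Matrix.diagonal α) w => ((x : GL (Fin N) ℂ) : Matrix (Fin N) (Fin N) ℂ)) hc
    simp only [Subgroup.coe_mul, Units.val_mul, coe_circleDiagonal] at h
    rw [hM]; exact h.symm
  have key := sum_conj_frame_eq_sum_frame q hij he hereal hαij hS' hMH hMM' hM'M hMd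
  simp only [hq] at key
  rw [hgm, hgm', ← hG, ← hG']
  simpa only [Matrix.mul_assoc] using key

/-- **THE TRACE-FORM INTEGRAND IS A CLASS FUNCTION ON `G_w ∕ Z(t₀)`**: the bracket of the trace form takes the same value at `g m` and at `g` for every `m ∈ Z_{G_w}(t₀)` and EVERY `Θ`
(`h_{gm} = h_g`; the Hessian sum by the previous theorem; `Q_{gm} = Q_g` by ★ 2a) — so it descends to the singular orbit `G_w·t₀ ≅ G_w∕Z(t₀)` (at `N = 3`: the ball `𝔹²`, via ★ `UnitBallSection`).
[cite: Rogawski1990, §8.4 p. 126] [cite: Varadarajan1989, §6.4] -/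
theorem third_trace_sub_gradient_mul_centralizer_eq (hα : ∀ i, α i ≠ 0) (hreal : ∀ i, (w.1.embedding (α i)).im = 0) {i j : Fin N} (hij : i ≠ j)
    (hαij : w.1.embedding (α i) = w.1.embedding (α j)) (ζ : Fin N → Circle) (hS : ∀ k, ζ k = ζ i ↔ (k = i ∨ k = j)) (Θ : Matrix (Fin N) (Fin N) ℂ → E)
    (g m : archLocal L N (Matrix.diagonal α) w)
    (hm : m ∈ Subgroup.centralizer ({(⟨circleDiagonal N ζ, circleDiagonal_mem_archLocal_diagonal L N α w ζ⟩ : archLocal L N (Matrix.diagonal α) w)} :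
      Set (archLocal L N (Matrix.diagonal α) w))) :
    ((1 / 3 : ℝ) • (iteratedFDeriv ℝ 2 Θ
          ((((g * m) * ⟨circleDiagonal N ζ, circleDiagonal_mem_archLocal_diagonal L N α w ζ⟩ * (g * m)⁻¹ : archLocal L N (Matrix.diagonal α) w) : GL (Fin N) ℂ) : Matrix (Fin N) (Fin N) ℂ)
          ![(ζ i : ℂ) • ((((g * m : archLocal L N (Matrix.diagonal α) w) : GL (Fin N) ℂ) : Matrix (Fin N) (Fin N) ℂ) * (I • (Matrix.single i i (1 : ℂ) - Matrix.single j j 1)) *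
              ((((g * m)⁻¹ : archLocal L N (Matrix.diagonal α) w) : GL (Fin N) ℂ) : Matrix (Fin N) (Fin N) ℂ)),
            (ζ i : ℂ) • ((((g * m : archLocal L N (Matrix.diagonal α) w) : GL (Fin N) ℂ) : Matrix (Fin N) (Fin N) ℂ) * (I • (Matrix.single i i (1 : ℂ) - Matrix.single j j 1)) *
              ((((g * m)⁻¹ : archLocal L N (Matrix.diagonal α) w) : GL (Fin N) ℂ) : Matrix (Fin N) (Fin N) ℂ))] +
        iteratedFDeriv ℝ 2 Θ
          ((((g * m) * ⟨circleDiagonal N ζ, circleDiagonal_mem_archLocal_diagonal L N α w ζ⟩ * (g * m)⁻¹ : archLocal L N (Matrix.diagonal α) w) : GL (Fin N) ℂ) : Matrix (Fin N) (Fin N) ℂ)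
          ![(ζ i : ℂ) • ((((g * m : archLocal L N (Matrix.diagonal α) w) : GL (Fin N) ℂ) : Matrix (Fin N) (Fin N) ℂ) * (Matrix.single i j (1 : ℂ) - Matrix.single j i 1) *
              ((((g * m)⁻¹ : archLocal L N (Matrix.diagonal α) w) : GL (Fin N) ℂ) : Matrix (Fin N) (Fin N) ℂ)),
            (ζ i : ℂ) • ((((g * m : archLocal L N (Matrix.diagonal α) w) : GL (Fin N) ℂ) : Matrix (Fin N) (Fin N) ℂ) * (Matrix.single i j (1 : ℂ) - Matrix.single j i 1) *
              ((((g * m)⁻¹ : archLocal L N (Matrix.diagonal α) w) : GL (Fin N) ℂ) : Matrix (Fin N) (Fin N) ℂ))] +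
        iteratedFDeriv ℝ 2 Θ
          ((((g * m) * ⟨circleDiagonal N ζ, circleDiagonal_mem_archLocal_diagonal L N α w ζ⟩ * (g * m)⁻¹ : archLocal L N (Matrix.diagonal α) w) : GL (Fin N) ℂ) : Matrix (Fin N) (Fin N) ℂ)
          ![(ζ i : ℂ) • ((((g * m : archLocal L N (Matrix.diagonal α) w) : GL (Fin N) ℂ) : Matrix (Fin N) (Fin N) ℂ) * (I • (Matrix.single i j (1 : ℂ) + Matrix.single j i 1)) *
              ((((g * m)⁻¹ : archLocal L N (Matrix.diagonal α) w) : GL (Fin N) ℂ) : Matrix (Fin N) (Fin N) ℂ)),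
            (ζ i : ℂ) • ((((g * m : archLocal L N (Matrix.diagonal α) w) : GL (Fin N) ℂ) : Matrix (Fin N) (Fin N) ℂ) * (I • (Matrix.single i j (1 : ℂ) + Matrix.single j i 1)) *
              ((((g * m)⁻¹ : archLocal L N (Matrix.diagonal α) w) : GL (Fin N) ℂ) : Matrix (Fin N) (Fin N) ℂ))]) -
      fderiv ℝ Θ
        ((((g * m) * ⟨circleDiagonal N ζ, circleDiagonal_mem_archLocal_diagonal L N α w ζ⟩ * (g * m)⁻¹ : archLocal L N (Matrix.diagonal α) w) : GL (Fin N) ℂ) : Matrix (Fin N) (Fin N) ℂ)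
        ((ζ i : ℂ) • ((((g * m : archLocal L N (Matrix.diagonal α) w) : GL (Fin N) ℂ) : Matrix (Fin N) (Fin N) ℂ) * (Matrix.single i i (1 : ℂ) + Matrix.single j j 1) *
          ((((g * m)⁻¹ : archLocal L N (Matrix.diagonal α) w) : GL (Fin N) ℂ) : Matrix (Fin N) (Fin N) ℂ)))) =
    ((1 / 3 : ℝ) • (iteratedFDeriv ℝ 2 Θ
          (((g * ⟨circleDiagonal N ζ, circleDiagonal_mem_archLocal_diagonal L N α w ζ⟩ * g⁻¹ : archLocal L N (Matrix.diagonal α) w) : GL (Fin N) ℂ) : Matrix (Fin N) (Fin N) ℂ)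
          ![(ζ i : ℂ) • ((((g : archLocal L N (Matrix.diagonal α) w) : GL (Fin N) ℂ) : Matrix (Fin N) (Fin N) ℂ) * (I • (Matrix.single i i (1 : ℂ) - Matrix.single j j 1)) *
              (((g⁻¹ : archLocal L N (Matrix.diagonal α) w) : GL (Fin N) ℂ) : Matrix (Fin N) (Fin N) ℂ)),
            (ζ i : ℂ) • ((((g : archLocal L N (Matrix.diagonal α) w) : GL (Fin N) ℂ) : Matrix (Fin N) (Fin N) ℂ) * (I • (Matrix.single i i (1 : ℂ) - Matrix.single j j 1)) *
              (((g⁻¹ : archLocal L N (Matrix.diagonal α) w) : GL (Fin N) ℂ) : Matrix (Fin N) (Fin N) ℂ))] +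
        iteratedFDeriv ℝ 2 Θ
          (((g * ⟨circleDiagonal N ζ, circleDiagonal_mem_archLocal_diagonal L N α w ζ⟩ * g⁻¹ : archLocal L N (Matrix.diagonal α) w) : GL (Fin N) ℂ) : Matrix (Fin N) (Fin N) ℂ)
          ![(ζ i : ℂ) • ((((g : archLocal L N (Matrix.diagonal α) w) : GL (Fin N) ℂ) : Matrix (Fin N) (Fin N) ℂ) * (Matrix.single i j (1 : ℂ) - Matrix.single j i 1) *
              (((g⁻¹ : archLocal L N (Matrix.diagonal α) w) : GL (Fin N) ℂ) : Matrix (Fin N) (Fin N) ℂ)),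
            (ζ i : ℂ) • ((((g : archLocal L N (Matrix.diagonal α) w) : GL (Fin N) ℂ) : Matrix (Fin N) (Fin N) ℂ) * (Matrix.single i j (1 : ℂ) - Matrix.single j i 1) *
              (((g⁻¹ : archLocal L N (Matrix.diagonal α) w) : GL (Fin N) ℂ) : Matrix (Fin N) (Fin N) ℂ))] +
        iteratedFDeriv ℝ 2 Θ
          (((g * ⟨circleDiagonal N ζ, circleDiagonal_mem_archLocal_diagonal L N α w ζ⟩ * g⁻¹ : archLocal L N (Matrix.diagonal α) w) : GL (Fin N) ℂ) : Matrix (Fin N) (Fin N) ℂ)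
          ![(ζ i : ℂ) • ((((g : archLocal L N (Matrix.diagonal α) w) : GL (Fin N) ℂ) : Matrix (Fin N) (Fin N) ℂ) * (I • (Matrix.single i j (1 : ℂ) + Matrix.single j i 1)) *
              (((g⁻¹ : archLocal L N (Matrix.diagonal α) w) : GL (Fin N) ℂ) : Matrix (Fin N) (Fin N) ℂ)),
            (ζ i : ℂ) • ((((g : archLocal L N (Matrix.diagonal α) w) : GL (Fin N) ℂ) : Matrix (Fin N) (Fin N) ℂ) * (I • (Matrix.single i j (1 : ℂ) + Matrix.single j i 1)) *
              (((g⁻¹ : archLocal L N (Matrix.diagonal α) w) : GL (Fin N) ℂ) : Matrix (Fin N) (Fin N) ℂ))]) -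
      fderiv ℝ Θ
        (((g * ⟨circleDiagonal N ζ, circleDiagonal_mem_archLocal_diagonal L N α w ζ⟩ * g⁻¹ : archLocal L N (Matrix.diagonal α) w) : GL (Fin N) ℂ) : Matrix (Fin N) (Fin N) ℂ)
        ((ζ i : ℂ) • ((((g : archLocal L N (Matrix.diagonal α) w) : GL (Fin N) ℂ) : Matrix (Fin N) (Fin N) ℂ) * (Matrix.single i i (1 : ℂ) + Matrix.single j j 1) *
          (((g⁻¹ : archLocal L N (Matrix.diagonal α) w) : GL (Fin N) ℂ) : Matrix (Fin N) (Fin N) ℂ)))) := by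
  have ht : (g * m) * (⟨circleDiagonal N ζ, circleDiagonal_mem_archLocal_diagonal L N α w ζ⟩ : archLocal L N (Matrix.diagonal α) w) * (g * m)⁻¹ =
      g * ⟨circleDiagonal N ζ, circleDiagonal_mem_archLocal_diagonal L N α w ζ⟩ * g⁻¹ := by
    have hc : (⟨circleDiagonal N ζ, circleDiagonal_mem_archLocal_diagonal L N α w ζ⟩ : archLocal L N (Matrix.diagonal α) w) * m =
        m * ⟨circleDiagonal N ζ, circleDiagonal_mem_archLocal_diagonal L N α w ζ⟩ :=
      Subgroup.mem_centralizer_iff.1 hm _ (Set.mem_singleton _)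
    rw [_root_.mul_inv_rev, mul_assoc g m, ← hc, ← mul_assoc, ← mul_assoc, mul_assoc (g * _) m, mul_inv_cancel, mul_one]
  have hS' : ∀ k, (ζ k : ℂ) = ζ i ↔ (k = i ∨ k = j) := fun k => by rw [← hS k]; exact ⟨fun h => Circle.ext h, fun h => by rw [h]⟩
  have hsum := sum_frame_conj_mul_centralizer_eq L N α w hα hreal hij hαij ζ hS
      (iteratedFDeriv ℝ 2 Θ (((g * ⟨circleDiagonal N ζ, circleDiagonal_mem_archLocal_diagonal L N α w ζ⟩ * g⁻¹ : archLocal L N (Matrix.diagonal α) w) :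
        GL (Fin N) ℂ) : Matrix (Fin N) (Fin N) ℂ)) (ζ i : ℂ) g m hm
  have hgrad := conj_mul_single_add_single_conj_eq_of_mem_centralizer L N α w ζ hij hS g m hm
  rw [ht, hgrad]
  exact congrArg (fun s => (1 / 3 : ℝ) • s - _) hsum

end Invariance


end Literature.NumberTheory.Automorphic.UnitaryGroup

end
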